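import Summits.QuantumAdvantage.QuantumAdvantage.Theorems.SosSandwichTransferPBPathBoundChain
import Summits.QuantumAdvantage.QuantumAdvantage.Theorems.SosSandwichTransferPBDescent
import Summits.QuantumAdvantage.QuantumAdvantage.Theorems.SosSandwichTransferPBDescentWalk
import Summits.QuantumAdvantage.QuantumAdvantage.Theorems.SosSandwichTransferPBEventMachineOSM
import Summits.QuantumAdvantage.QuantumAdvantage.Theorems.SosSandwichTransferPBEventOSMFinal
import Summits.QuantumAdvantage.QuantumAdvantage.Theorems.SosSandwichTransferPBNodePromiseBQP
import Summits.QuantumAdvantage.QuantumAdvantage.Theorems.SosSandwichTransferPB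
import HarnessLib

/-!
# `TransferPB` with the PATH-WISE influence bound instead of PB-AA — the machine-reduction chain re-threaded, part 2

Route `SosSandwich`; repair census of crux `PseudoBoundedAA` (stmt-QuantumAdvantage-15237) at route level.  The closed crux
`TransferPB` (stmt-15238) consumes `PseudoBoundedAA` at one point only — `SimTreePB.complete_of_pb` in the live root
`SimTreePB.oracleSimulation_of_potentialMachines` — i.e. for the restrictions `p_x|_ρ` of oracle-circuit acceptance polynomials
(acceptance probabilities of genuine quantum algorithms with part of the oracle fixed), never for a general member of the SOS
class `K_T`.  This file and its sequel re-thread the machine-reduction chain of the line `birth` of `TransferPB` with the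
hypothesis

  `AApath := ∃ c C₀ > 0, ∀ F x ρ ε, 0 < ε ≤ Var[p_x|_ρ] → ∃ i, C₀ (ε / thm23Degree F x)^c ≤ Inf_i[p_x|_ρ]`

in place of `PseudoBoundedAA` (statements and proofs VERBATIM twins of the tree's, conclusions `AApath → OracleSimulation`):
`oracleSimulation_of_potentialMachines_path` (root: `complete_of_pb` replaced by the hypothesis, dyadic rounding inlined;
stub 1 is no longer needed), `…_of_magnitudeMachines_path`, `…_of_bbbvMachines_path`, `…_of_keptMachines_path`,
`…_of_nodeProblem_consistent_path`.  Part 2 (`…PathBoundChainFinal`) continues with the descent / string / event machines and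
assembles `AApath → PromiseBQP ⊆ PromiseBPP' → ∀ᵐ A, BQP^A ⊆ AvgP^A`.  Honest label: re-threading of landed proofs; nothing new
about machines is claimed.  No named fact; axioms standard.
Sources: AaronsonAmbainis2014 Thm. 21/23; BennettBernsteinBrassardVazirani1997; Zhandry2012.
-/

-- D-0017: single-conjunct summit ⇒ the duplicate `QuantumAdvantage.QuantumAdvantage` is mandated.
set_option linter.dupNamespace false

noncomputable section

namespace Summit.QuantumAdvantage.QuantumAdvantage.Cruxes.TransferPB.Birth

open Finset MeasureTheory Literature.Computability.Cryptography Literature.Computability.Complexity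
  Literature.Computability.QuantumComplexity Literature.Computability.QuantumComplexity.ClassicalSimulation
open Summit.QuantumAdvantage.QuantumAdvantage.Theses.SosSandwich
open scoped ENNReal

namespace SimTreePB

/-- **Descent-machine level, path-wise bound** (twin of `stub_pbOracleSimulation_of_descentMachines`, proof verbatim). [cite: AaronsonAmbainis2014, Thm. 23 (proof, p. 14)] -/
theorem oracleSimulation_of_descentMachines_path
    (hQ : ∀ (c k : ℕ) (F : QCircuitFamily cliffordT), F.IsUniform → ∀ r : Polynomial ℕ,
      nodeProblem F r c k ∈ Literature.Computability.Cryptography.PromiseBQP)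
    (hM : ∀ (c k : ℕ) (F : QCircuitFamily cliffordT), F.IsUniform → ∀ r : Polynomial ℕ,
      ∃ (C : OracleAlg Bool) (q : Polynomial ℕ),
        C.IsPolyTime Computability.encodingBoolBool ∧
        (∀ (O : Oracle) (x : List Bool), ∀ y ∈ C.queries O (q.eval x.length) x, y.length ≤ q.eval x.length) ∧
        ∀ x : List Bool, 1 ≤ x.length → ∀ g : List Bool → Bool,
          (∀ v ∈ (nodeProblem F r c k).yes, g v = true) → (∀ v ∈ (nodeProblem F r c k).no, g v = false) →
          ∃ D : ℕ, machineBudget F x r c k ≤ D ∧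
            ∀ A : Set (List Bool),
              C.run (Oracle.ofLanguage {w : List Bool | ∃ v : List Bool,
                  (w = false :: v ∧ v ∈ A) ∨ (w = true :: v ∧ g v = true)}) (q.eval x.length) x =
                some (decide (1 / 2 ≤
                  (advTree (descentAdvisor F x g) D []).eval (oracleBits F x A)))) :
    (∃ (c : ℕ) (C₀ : ℝ), 0 < C₀ ∧ ∀ (F : QCircuitFamily cliffordT) (x : List Bool)
      (ρ : List (Fin (numOracleBits F x) × Bool)) (ε : ℝ), 0 < ε →
      ε ≤ boolVariance (restrictPath ρ (acceptPoly F x)) →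
        ∃ i : Fin (numOracleBits F x),
          C₀ * (ε / thm23Degree F x) ^ c ≤ influence i (restrictPath ρ (acceptPoly F x))) →
      OracleSimulation := by
  refine oracleSimulation_of_keptMachines_path hQ fun c k F hF r => ?_
  obtain ⟨C, q, hCpoly, hCq, hrun⟩ := hM c k F hF r
  refine ⟨C, q, hCpoly, hCq, fun x hx g hgy hgn => ?_⟩
  obtain ⟨D, hD, hrunA⟩ := hrun x hx g hgy hgn
  exact ⟨descentAdvisor F x g, D, hD, fun ρ s h => descentAdvisor_pick_some h,
    fun ρ h => descentAdvisor_pick_none h, descentAdvisor_val_eq, hrunA⟩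

/-- **String-machine level, path-wise bound** (twin of `stub_pbOracleSimulation_of_stringMachines`, proof verbatim). [cite: AaronsonAmbainis2014, Thm. 23 (proof, p. 14)] -/
theorem oracleSimulation_of_stringMachines_path
    (hQ : ∀ (c k : ℕ) (F : QCircuitFamily cliffordT), F.IsUniform → ∀ r : Polynomial ℕ,
      nodeProblem F r c k ∈ Literature.Computability.Cryptography.PromiseBQP)
    (hM : ∀ (c k : ℕ) (F : QCircuitFamily cliffordT), F.IsUniform → ∀ r : Polynomial ℕ,
      ∃ (C : OracleAlg Bool) (q : Polynomial ℕ),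
        C.IsPolyTime Computability.encodingBoolBool ∧
        (∀ (O : Oracle) (x : List Bool), ∀ y ∈ C.queries O (q.eval x.length) x, y.length ≤ q.eval x.length) ∧
        ∀ x : List Bool, 1 ≤ x.length → ∀ g : List Bool → Bool,
          (∀ v ∈ (nodeProblem F r c k).yes, g v = true) → (∀ v ∈ (nodeProblem F r c k).no, g v = false) →
          ∃ (W' D : ℕ), oracleWidth F x ≤ W' ∧ machineBudget F x r c k ≤ D ∧
            ∀ A : Set (List Bool),
              C.run (Oracle.ofLanguage {w : List Bool | ∃ v : List Bool,
                  (w = false :: v ∧ v ∈ A) ∨ (w = true :: v ∧ g v = true)}) (q.eval x.length) x =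
                some (decide (20 ≤ meanCount g x (strWalk g x W' (fun u => A.boolIndicator u) D [])))) :
    (∃ (c : ℕ) (C₀ : ℝ), 0 < C₀ ∧ ∀ (F : QCircuitFamily cliffordT) (x : List Bool)
      (ρ : List (Fin (numOracleBits F x) × Bool)) (ε : ℝ), 0 < ε →
      ε ≤ boolVariance (restrictPath ρ (acceptPoly F x)) →
        ∃ i : Fin (numOracleBits F x),
          C₀ * (ε / thm23Degree F x) ^ c ≤ influence i (restrictPath ρ (acceptPoly F x))) →
      OracleSimulation := by
  refine oracleSimulation_of_descentMachines_path hQ fun c k F hF r => ?_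
  obtain ⟨C, q, hCpoly, hCq, hrun⟩ := hM c k F hF r
  refine ⟨C, q, hCpoly, hCq, fun x hx g hgy hgn => ?_⟩
  obtain ⟨W', D, hW, hD, hrunA⟩ := hrun x hx g hgy hgn
  refine ⟨D, hD, fun A => ?_⟩
  rw [hrunA A, decide_eval_advTree_descentAdvisor, ← strPath_nil F x,
    strWalk_eq_of_le hgn (fun u => A.boolIndicator u) hW D []]

/-- **Event-machine level, path-wise bound** (twin of `stub_pbOracleSimulation_of_eventOSM`, proof verbatim). [cite: AaronsonAmbainis2014, Thm. 23 (proof, p. 14)] -/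
theorem oracleSimulation_of_eventOSM_path
    (hQ : ∀ (c k : ℕ) (F : QCircuitFamily cliffordT), F.IsUniform → ∀ r : Polynomial ℕ,
      nodeProblem F r c k ∈ Literature.Computability.Cryptography.PromiseBQP)
    (hE : ∀ pw pd : Polynomial ℕ, ∃ (S : OSM) (enc : List Bool → EvState → List Bool) (G : Polynomial ℕ),
      S.ini ∈ FP ∧ S.del ∈ FP ∧ S.kap ∈ FP ∧
      (∀ (x st : List Bool) (b : Bool), (S.del (boolPair x (boolPair st [b]))).length ≤ st.length + G.eval x.length) ∧
      (∀ x : List Bool, S.ini x = enc x (evInit (pd.eval x.length))) ∧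
      (∀ (x : List Bool) (s : EvState) (b : Bool), EvInv (pw.eval x.length) (pd.eval x.length) s →
        S.del (boolPair x (boolPair (enc x s) [b])) = enc x (evDelta (pw.eval x.length) s b)) ∧
      (∀ (x : List Bool) (s : EvState), EvInv (pw.eval x.length) (pd.eval x.length) s →
        S.kap (boolPair x (enc x s)) = Sum.elim (fun q => false :: q) (fun b => [true, b]) (evKappa x s))) :
    (∃ (c : ℕ) (C₀ : ℝ), 0 < C₀ ∧ ∀ (F : QCircuitFamily cliffordT) (x : List Bool)
      (ρ : List (Fin (numOracleBits F x) × Bool)) (ε : ℝ), 0 < ε →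
      ε ≤ boolVariance (restrictPath ρ (acceptPoly F x)) →
        ∃ i : Fin (numOracleBits F x),
          C₀ * (ε / thm23Degree F x) ^ c ≤ influence i (restrictPath ρ (acceptPoly F x))) →
      OracleSimulation := by
  refine oracleSimulation_of_stringMachines_path hQ fun c k F hF r => ?_
  obtain ⟨s, hs⟩ := QCircuitFamily.IsUniform.isPolySize' hF
  let Lp : Polynomial ℕ :=
    Polynomial.C 8 * s ^ 2 * Polynomial.C (2 ^ k) * (Polynomial.C 400 * (Polynomial.C 2 * s + 1) * (r + 1)) ^ c
  let pw : Polynomial ℕ := Polynomial.X + s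
  let pd : Polynomial ℕ := Polynomial.C 2 * Lp * (r + 1) + 1
  have hLp : ∀ n : ℕ, Lp.eval n = 8 * (s.eval n) ^ 2 * 2 ^ k * (400 * (2 * s.eval n + 1) * (r.eval n + 1)) ^ c := by
    intro n; simp [Lp]
  have hpw : ∀ n : ℕ, pw.eval n = n + s.eval n := by intro n; simp [pw]
  have hpd : ∀ n : ℕ, pd.eval n = 2 * Lp.eval n * (r.eval n + 1) + 1 := by intro n; simp [pd]
  obtain ⟨S, enc, G, hiniFP, hdelFP, hkapFP, hG, hini, hdel, hkap⟩ := hE pw pd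
  let q : Polynomial ℕ :=
    pd * (Polynomial.C 3 * (pw * Lp) + Polynomial.C 2) + Polynomial.C 41 +
      (Polynomial.C 2 * Polynomial.X + Polynomial.C 2 * pd * (Polynomial.C 2 * pw + Polynomial.C 4) + pw + Polynomial.C 50)
  have hq : ∀ n : ℕ, q.eval n = pd.eval n * (3 * (pw.eval n * Lp.eval n) + 2) + 41 +
      (2 * n + 2 * pd.eval n * (2 * pw.eval n + 4) + pw.eval n + 50) := by
    intro n; simp [q]
  refine ⟨S.alg.mapOut Computability.decodeBool, q,
    isPolyTime_mapOut_decodeBool (S.isPolyTime_alg hiniFP hdelFP hkapFP hG), fun O x y hy => ?_,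
    fun x _ g _ hgn => ?_⟩
  · -- query lengths
    have h := length_le_of_mem_queries_osm_mapOut (hini x) (hdel x) (hkap x) O _ hy
    unfold evQueryBound at h
    rw [hq]
    omega
  · -- runs within the round budget
    have hW : oracleWidth F x ≤ pw.eval x.length := by
      show x.length + F.ancillas x.length ≤ pw.eval x.length
      rw [hpw]
      exact Nat.add_le_add_left (hs x.length).2 _
    have hT : (F.circ x.length).oracleQueries ≤ s.eval x.length :=
      (QCircuit.oracleQueries_le_size _).trans (hs x.length).1
    have hBL : 8 * (F.circ x.length).oracleQueries ^ 2 * 2 ^ k * (400 * thm23Degree F x * (r.eval x.length + 1)) ^ c ≤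
        Lp.eval x.length := by
      rw [hLp]; exact liveBoundNat_mono (r := r) (c := c) (k := k) hT
    have hD : machineBudget F x r c k ≤ pd.eval x.length := by
      rw [machineBudget_eq_nat, hpd]
      gcongr
    refine ⟨pw.eval x.length, pd.eval x.length, hW, hD, fun A => ?_⟩
    rw [run_osm_mapOut (hini x) (hdel x) (hkap x)]
    obtain ⟨m, hm, hrun⟩ := evLoop_evInit x (pw.eval x.length)
      (O := fun q' => Set.boolIndicator {w : List Bool | ∃ v : List Bool,
        (w = false :: v ∧ v ∈ A) ∨ (w = true :: v ∧ g v = true)} q')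
      (g := g) (inA := fun u => A.boolIndicator u)
      (boolIndicator_combined_true A g) (boolIndicator_combined_false A g)
      (fun π => ∃ ρ : List (Fin (numOracleBits F x) × Bool), π = strPath F x ρ) ⟨[], (strPath_nil F x).symm⟩
      (fun π hπ j => by obtain ⟨ρ, rfl⟩ := hπ; exact length_liveLevel_strPath_le hgn ρ j)
      (fun π hπ u hu => by
        obtain ⟨ρ, rfl⟩ := hπ
        obtain ⟨ρ', h⟩ := strPath_step_descentPick hgn hW ρ hu (A.boolIndicator u)
        exact ⟨ρ', h⟩) (pd.eval x.length)
    refine hrun _ (hm.trans ?_)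
    have h2 : pd.eval x.length * (3 * (pw.eval x.length * (8 * (F.circ x.length).oracleQueries ^ 2 * 2 ^ k *
        (400 * thm23Degree F x * (r.eval x.length + 1)) ^ c)) + 2) ≤
        pd.eval x.length * (3 * (pw.eval x.length * Lp.eval x.length) + 2) := by
      gcongr
    rw [hq]
    omega

/-- **The event-driven chain, path-wise bound** (twin of `EvOSM.stub_pbOracleSimulation_of_Q`): `OracleSimulation` from
(Q) `nodeProblem ∈ PromiseBQP` and `AApath`. [cite: AaronsonAmbainis2014, Thm. 23 (proof, p. 14)] -/
theorem oracleSimulation_of_Q_path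
    (hQ : ∀ (c k : ℕ) (F : QCircuitFamily cliffordT), F.IsUniform → ∀ r : Polynomial ℕ,
      nodeProblem F r c k ∈ Literature.Computability.Cryptography.PromiseBQP) :
    (∃ (c : ℕ) (C₀ : ℝ), 0 < C₀ ∧ ∀ (F : QCircuitFamily cliffordT) (x : List Bool)
      (ρ : List (Fin (numOracleBits F x) × Bool)) (ε : ℝ), 0 < ε →
      ε ≤ boolVariance (restrictPath ρ (acceptPoly F x)) →
        ∃ i : Fin (numOracleBits F x),
          C₀ * (ε / thm23Degree F x) ^ c ≤ influence i (restrictPath ρ (acceptPoly F x))) →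
      OracleSimulation :=
  oracleSimulation_of_eventOSM_path hQ EvOSM.eventOSM_spec

/-- **`TransferPB` with PB-AA replaced by the path-wise AA bound.**  Granted
`AApath : ∃ c C₀ > 0, ∀ F x ρ ε, 0 < ε ≤ Var[p_x|_ρ] → ∃ i, C₀ (ε/thm23Degree F x)^c ≤ Inf_i[p_x|_ρ]` — the Aaronson–Ambainis
influence bound ONLY for restrictions of Clifford+T oracle-circuit acceptance polynomials (quantum acceptance probabilities with
part of the oracle fixed; implied by `PseudoBoundedAA` via `SimTreePB.pathBound_of_pseudoBoundedAA`) — if `PromiseBQP ⊆ PromiseBPP'`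
then `BQP^A ⊆ AvgP^A` for almost every random oracle `A`.  All machine / quantum halves are the tree's
(`nodeProblem_mem_PromiseBQP`, `EvOSM.eventOSM_spec`, `stub_promiseOracleElimination`, glue
`TransferPBGlue.ae_BQPRel_subset_AvgPRel_of_simulation`).  So the summit assembly of route SosSandwich runs with its analytic
crux weakened from PB-AA (SOS class `K_T`) to `AApath` (`Q_T`-type polynomials). [cite: AaronsonAmbainis2014, Thm. 7(iii), Thm. 23] -/
theorem transfer_of_pathBound
    (hAA : ∃ (c : ℕ) (C₀ : ℝ), 0 < C₀ ∧ ∀ (F : QCircuitFamily cliffordT) (x : List Bool)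
      (ρ : List (Fin (numOracleBits F x) × Bool)) (ε : ℝ), 0 < ε →
      ε ≤ boolVariance (restrictPath ρ (acceptPoly F x)) →
        ∃ i : Fin (numOracleBits F x),
          C₀ * (ε / thm23Degree F x) ^ c ≤ influence i (restrictPath ρ (acceptPoly F x)))
    (hPr : Literature.Computability.Cryptography.PromiseBQP ⊆ Literature.Computability.Complexity.PromiseBPP') :
    ∀ᵐ A ∂randomOracle,
      BQPRel (A : Language Bool) ⊆
        Literature.Computability.Complexity.AvgPRel (Oracle.ofLanguage (A : Language Bool)) :=
  Summit.QuantumAdvantage.QuantumAdvantage.Theorems.SosSandwich.TransferPBGlue.ae_BQPRel_subset_AvgPRel_of_simulation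
    (oracleSimulation_of_Q_path (fun c k _ hF r => nodeProblem_mem_PromiseBQP r c k hF) hAA)
    stub_promiseOracleElimination hPr

/-- **The summit assembly with the weakened analytic crux**: `AApath → RandomOracleHeurSeparation → PromiseLanguageLift →
QuantumAdvantage` (the route's `closes` with `TransferPB ∘ PseudoBoundedAA` replaced by `transfer_of_pathBound`).
[cite: AaronsonAmbainis2014, Thm. 7(iii)] -/
theorem quantumAdvantage_of_pathBound
    (hAA : ∃ (c : ℕ) (C₀ : ℝ), 0 < C₀ ∧ ∀ (F : QCircuitFamily cliffordT) (x : List Bool)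
      (ρ : List (Fin (numOracleBits F x) × Bool)) (ε : ℝ), 0 < ε →
      ε ≤ boolVariance (restrictPath ρ (acceptPoly F x)) →
        ∃ i : Fin (numOracleBits F x),
          C₀ * (ε / thm23Degree F x) ^ c ≤ influence i (restrictPath ρ (acceptPoly F x)))
    (hX : RandomOracleHeurSeparation) (hPL : PromiseLanguageLift) : _root_.QuantumAdvantage := by
  by_contra hS
  refine hX (transfer_of_pathBound hAA (hPL ?_))
  intro L hL
  by_contra hL'
  exact hS ⟨L, hL, hL'⟩

end SimTreePB

end Summit.QuantumAdvantage.QuantumAdvantage.Cruxes.TransferPB.Birth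

end
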